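import Mathlib
import HarnessLib
import Summits.NavierStokesRegularity.NavierStokesRegularity.Theorems.PoloidalWindowDoorPoloidalWindowRigidityHotHullCompactness
import Summits.NavierStokesRegularity.NavierStokesRegularity.Theorems.PoloidalWindowDoorPoloidalWindowRigidityHotHullLeafLimit
import Summits.NavierStokesRegularity.NavierStokesRegularity.Theorems.PoloidalWindowDoorPoloidalWindowRigidityHotHullSlabUniform
import Summits.NavierStokesRegularity.NavierStokesRegularity.Theorems.PoloidalWindowDoorPoloidalWindowRigidityHotHullSliding
import Summits.NavierStokesRegularity.NavierStokesRegularity.Theorems.PoloidalWindowDoorPoloidalWindowRigidityLeafUniformVortexLine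

/-!
# Route `PoloidalWindowDoor`, crux `PoloidalWindowRigidity` (K2, stmt-NavierStokesRegularity-19708) — LINE 21 «hot_hull» (ns-idea-8): the SLIDING HULL of an
# escaping hot end (helper S6a of H6 `LeafRecurrence`), `Pinned` / `Peakless` / `hotSet` delta-unfolded

Cell ns-regularity-ideate, seat ns-poloidal-K2-p2 g14 (K2 stub-worker hand, H6 under DIRECTOR-NS #288).  A HULL MEMBER of the end `l` of the hot leaf `γ`
of `v` is a pinned peakless profile `U` together with times `τs k → l` along which the translates `v(·, · + γ(τs k))` converge to `U` locally uniformly on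
every slice and the vorticity slices at `−1` converge locally uniformly.  This file proves the three structural facts the Birkhoff step
(`…HotHullRecurrence.exists_uniformly_recurrent`) consumes:

* `hull_leaf` — the leaf `γ_U` of a hull member through `0` (any global integral curve of `ω_U(−1,·)` through `0`; unique by
  `…HotHullSliding.leaf_unique`) is HOT and is the limit of the re-based leaves `γ(τs k + σ) − γ(τs k)` (H5 `…HotHullLeafLimit.leafLimit`);
  `hull_hot_value` — a hull member has the hot value `N` of `v`.
* `sliding_invariant` — sliding a hull member along its leaf gives a hull member, witnessed by the shifted times `τs k + σ` (H1 `pinned_translate` /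
  `peakless_translate` at the hot point `γ_U σ`; convergence by `…HotHullSliding.tendstoLocallyUniformly_comp_add`).
* `hull_diagonal` — a slice-wise limit of hull members is a hull member (diagonal witness sequence; the class-uniform moduli of
  `…HotHullSlabUniform.tendstoUniformlyOn_slab` make "close on the `j`-th slab" a countable family of conditions).

WHAT THIS IS NOT: not a claim about Navier–Stokes regularity — bookkeeping for a support of a PASSed research decomposition of ⟨19708⟩'s residues
(bears_on LADDER-NS N0, rung N0-LocalTubeDoorPoloidal); research cells OPEN; crux 19708 / item 20428 OPEN; NS regularity NOT proved.
-/

noncomputable section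

-- the summit and its single sub-problem share the name (CONVENTIONS §1), as in every Theorems file
set_option linter.dupNamespace false

namespace Summit.NavierStokesRegularity.NavierStokesRegularity.Theorems.PoloidalWindowDoorPoloidalWindowRigidityHotHullSlidingHull

open Set Function Filter Topology Metric
open scoped InnerProductSpace RealInnerProductSpace Laplacian NNReal
open Literature.Analysis Literature.Analysis.FluidPDE Literature.Analysis.UnboundedOperators
open Summit.NavierStokesRegularity.NavierStokesRegularity.Theorems
open PoloidalWindowDoorPoloidalWindowRigidityHotHullCompactness PoloidalWindowDoorPoloidalWindowRigidityHotHullLeafLimit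
  PoloidalWindowDoorPoloidalWindowRigidityHotHullSlabUniform PoloidalWindowDoorPoloidalWindowRigidityHotHullSliding
  PoloidalWindowDoorPoloidalWindowRigidityLeafUniformVortexLine

/-- **A hull member has the hot value of `v`** (`U₂(−1,0) = N`). -/
theorem hull_hot_value {C : ℝ} {v U : ℝ → EuclideanSpace ℝ (Fin 3) → EuclideanSpace ℝ (Fin 3)} {γ : ℝ → EuclideanSpace ℝ (Fin 3)} {τs : ℕ → ℝ}
    (hhot : ∀ τ : ℝ, γ τ ∈ {q : EuclideanSpace ℝ (Fin 3) | q 2 = 0 ∧ v (-1) q 2 = v (-1) 0 2})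
    (hPU : (Literature.Analysis.FluidPDE.HasTypeITimeDecay C U ∧
        ContinuousOn (Function.uncurry U) (Set.Iio (0 : ℝ) ×ˢ Set.univ) ∧
        (∀ s t : ℝ, s < t → t < 0 → ∀ x, U t x =
          Literature.Analysis.UnboundedOperators.heatExtension (U s) (t - s) x -
            Literature.Analysis.FluidPDE.oseenDuhamel 1 s U U t x) ∧
        (∀ t < 0, Literature.Analysis.FluidPDE.VectorCalculus.IsDivFree (U t)) ∧
        (∀ s < 0, ∀ q, ⟪Literature.Analysis.FluidPDE.curl (U s) q, EuclideanSpace.single 2 1⟫_ℝ = 0) ∧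
        U (-1) 0 2 ≠ 0 ∧ (∀ t < 0, ∀ x, Real.sqrt (-t) * |U t x 2| ≤ |U (-1) 0 2|) ∧
        (∀ h : EuclideanSpace ℝ (Fin 3), fderiv ℝ (U (-1)) 0 h 2 = 0) ∧
        (deriv (fun s => U s 0 2) (-1) = U (-1) 0 2 / 2 ∧ U (-1) 0 2 * (Δ (fun q => U (-1) q 2)) 0 ≤ 0)))
    (hV : TendstoLocallyUniformly (fun k x => v (-1) (x + γ (τs k))) (U (-1)) atTop) :
    U (-1) 0 2 = v (-1) 0 2 := by
  have hUc : Continuous (U (-1)) := continuous_slice_of_class hPU.1 hPU.2.1 hPU.2.2.1 hPU.2.2.2.1 (by norm_num)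
  have h1 : Tendsto (fun k => v (-1) ((0 : EuclideanSpace ℝ (Fin 3)) + γ (τs k))) atTop (𝓝 (U (-1) 0)) :=
    hV.tendsto_comp hUc.continuousAt tendsto_const_nhds
  have h2 : Tendsto (fun k => v (-1) ((0 : EuclideanSpace ℝ (Fin 3)) + γ (τs k)) 2) atTop (𝓝 (U (-1) 0 2)) :=
    ((EuclideanSpace.proj (𝕜 := ℝ) (2 : Fin 3)).continuous.tendsto _).comp h1
  have h3 : (fun k => v (-1) ((0 : EuclideanSpace ℝ (Fin 3)) + γ (τs k)) 2) = fun _ => v (-1) 0 2 := funext fun k => by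
    rw [zero_add]
    exact (hhot (τs k)).2
  rw [h3] at h2
  exact tendsto_nhds_unique h2 tendsto_const_nhds

/-- **The leaf of a hull member is hot and is the limit of the re-based leaves** (H5 + uniqueness of leaves). -/
theorem hull_leaf {C : ℝ} {v U : ℝ → EuclideanSpace ℝ (Fin 3) → EuclideanSpace ℝ (Fin 3)} {γ : ℝ → EuclideanSpace ℝ (Fin 3)} {τs : ℕ → ℝ}
    (hP : (Literature.Analysis.FluidPDE.HasTypeITimeDecay C v ∧
        ContinuousOn (Function.uncurry v) (Set.Iio (0 : ℝ) ×ˢ Set.univ) ∧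
        (∀ s t : ℝ, s < t → t < 0 → ∀ x, v t x =
          Literature.Analysis.UnboundedOperators.heatExtension (v s) (t - s) x -
            Literature.Analysis.FluidPDE.oseenDuhamel 1 s v v t x) ∧
        (∀ t < 0, Literature.Analysis.FluidPDE.VectorCalculus.IsDivFree (v t)) ∧
        (∀ s < 0, ∀ q, ⟪Literature.Analysis.FluidPDE.curl (v s) q, EuclideanSpace.single 2 1⟫_ℝ = 0) ∧
        v (-1) 0 2 ≠ 0 ∧ (∀ t < 0, ∀ x, Real.sqrt (-t) * |v t x 2| ≤ |v (-1) 0 2|) ∧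
        (∀ h : EuclideanSpace ℝ (Fin 3), fderiv ℝ (v (-1)) 0 h 2 = 0) ∧
        (deriv (fun s => v s 0 2) (-1) = v (-1) 0 2 / 2 ∧ v (-1) 0 2 * (Δ (fun q => v (-1) q 2)) 0 ≤ 0)))
    (hγ : ∀ τ : ℝ, HasDerivAt γ (curl (v (-1)) (γ τ)) τ) (hhot : ∀ τ : ℝ, γ τ ∈ {q : EuclideanSpace ℝ (Fin 3) | q 2 = 0 ∧ v (-1) q 2 = v (-1) 0 2})
    (hPU : (Literature.Analysis.FluidPDE.HasTypeITimeDecay C U ∧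
        ContinuousOn (Function.uncurry U) (Set.Iio (0 : ℝ) ×ˢ Set.univ) ∧
        (∀ s t : ℝ, s < t → t < 0 → ∀ x, U t x =
          Literature.Analysis.UnboundedOperators.heatExtension (U s) (t - s) x -
            Literature.Analysis.FluidPDE.oseenDuhamel 1 s U U t x) ∧
        (∀ t < 0, Literature.Analysis.FluidPDE.VectorCalculus.IsDivFree (U t)) ∧
        (∀ s < 0, ∀ q, ⟪Literature.Analysis.FluidPDE.curl (U s) q, EuclideanSpace.single 2 1⟫_ℝ = 0) ∧
        U (-1) 0 2 ≠ 0 ∧ (∀ t < 0, ∀ x, Real.sqrt (-t) * |U t x 2| ≤ |U (-1) 0 2|) ∧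
        (∀ h : EuclideanSpace ℝ (Fin 3), fderiv ℝ (U (-1)) 0 h 2 = 0) ∧
        (deriv (fun s => U s 0 2) (-1) = U (-1) 0 2 / 2 ∧ U (-1) 0 2 * (Δ (fun q => U (-1) q 2)) 0 ≤ 0)))
    (hV : TendstoLocallyUniformly (fun k x => v (-1) (x + γ (τs k))) (U (-1)) atTop)
    (hW : TendstoLocallyUniformly (fun k x => curl (v (-1)) (x + γ (τs k))) (curl (U (-1))) atTop)
    {γU : ℝ → EuclideanSpace ℝ (Fin 3)} (hγU0 : γU 0 = 0) (hγU : ∀ σ, HasDerivAt γU (curl (U (-1)) (γU σ)) σ) :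
    (∀ σ : ℝ, γU σ ∈ {q : EuclideanSpace ℝ (Fin 3) | q 2 = 0 ∧ U (-1) q 2 = U (-1) 0 2}) ∧
      ∀ σ : ℝ, Tendsto (fun k => γ (τs k + σ) - γ (τs k)) atTop (𝓝 (γU σ)) := by
  obtain ⟨KU, LU, hKU, hLU⟩ := curl_slice_bounded_lipschitz hPU.1 hPU.2.1 hPU.2.2.1 hPU.2.2.2.1 (by norm_num : (-1 : ℝ) < 0)
  obtain ⟨Kv, Lv, -, hLv⟩ := curl_slice_bounded_lipschitz hP.1 hP.2.1 hP.2.2.1 hP.2.2.2.1 (by norm_num : (-1 : ℝ) < 0)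
  have hUc : Continuous (U (-1)) := continuous_slice_of_class hPU.1 hPU.2.1 hPU.2.2.1 hPU.2.2.2.1 (by norm_num)
  have hHc : IsClosed {q : EuclideanSpace ℝ (Fin 3) | q 2 = 0 ∧ U (-1) q 2 = U (-1) 0 2} := by
    rw [Set.setOf_and]
    exact (isClosed_eq (EuclideanSpace.proj (𝕜 := ℝ) (2 : Fin 3)).continuous continuous_const).inter
      (isClosed_eq ((EuclideanSpace.proj (𝕜 := ℝ) (2 : Fin 3)).continuous.comp hUc) continuous_const)
  obtain ⟨γU', hγU'0, hγU', hhot', hconv'⟩ := leafLimit v U γ τs hγ hhot ⟨KU, hKU⟩ ⟨Lv, hLv⟩ ⟨LU, hLU⟩ hHc hUc hV hW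
  have e : γU = γU' := leaf_unique hKU hγU hγU' (by rw [hγU0, hγU'0])
  subst e
  exact ⟨hhot', hconv'⟩

/-- **Sliding a hull member along its leaf gives a hull member**, witnessed by the shifted times. -/
theorem sliding_invariant {C : ℝ} {v U : ℝ → EuclideanSpace ℝ (Fin 3) → EuclideanSpace ℝ (Fin 3)} {γ : ℝ → EuclideanSpace ℝ (Fin 3)} {τs : ℕ → ℝ}
    {l : Filter ℝ} (hl : l = Filter.atTop ∨ l = Filter.atBot)
    (hP : (Literature.Analysis.FluidPDE.HasTypeITimeDecay C v ∧
        ContinuousOn (Function.uncurry v) (Set.Iio (0 : ℝ) ×ˢ Set.univ) ∧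
        (∀ s t : ℝ, s < t → t < 0 → ∀ x, v t x =
          Literature.Analysis.UnboundedOperators.heatExtension (v s) (t - s) x -
            Literature.Analysis.FluidPDE.oseenDuhamel 1 s v v t x) ∧
        (∀ t < 0, Literature.Analysis.FluidPDE.VectorCalculus.IsDivFree (v t)) ∧
        (∀ s < 0, ∀ q, ⟪Literature.Analysis.FluidPDE.curl (v s) q, EuclideanSpace.single 2 1⟫_ℝ = 0) ∧
        v (-1) 0 2 ≠ 0 ∧ (∀ t < 0, ∀ x, Real.sqrt (-t) * |v t x 2| ≤ |v (-1) 0 2|) ∧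
        (∀ h : EuclideanSpace ℝ (Fin 3), fderiv ℝ (v (-1)) 0 h 2 = 0) ∧
        (deriv (fun s => v s 0 2) (-1) = v (-1) 0 2 / 2 ∧ v (-1) 0 2 * (Δ (fun q => v (-1) q 2)) 0 ≤ 0)))
    (hγ : ∀ τ : ℝ, HasDerivAt γ (curl (v (-1)) (γ τ)) τ) (hhot : ∀ τ : ℝ, γ τ ∈ {q : EuclideanSpace ℝ (Fin 3) | q 2 = 0 ∧ v (-1) q 2 = v (-1) 0 2})
    (hPU : (Literature.Analysis.FluidPDE.HasTypeITimeDecay C U ∧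
        ContinuousOn (Function.uncurry U) (Set.Iio (0 : ℝ) ×ˢ Set.univ) ∧
        (∀ s t : ℝ, s < t → t < 0 → ∀ x, U t x =
          Literature.Analysis.UnboundedOperators.heatExtension (U s) (t - s) x -
            Literature.Analysis.FluidPDE.oseenDuhamel 1 s U U t x) ∧
        (∀ t < 0, Literature.Analysis.FluidPDE.VectorCalculus.IsDivFree (U t)) ∧
        (∀ s < 0, ∀ q, ⟪Literature.Analysis.FluidPDE.curl (U s) q, EuclideanSpace.single 2 1⟫_ℝ = 0) ∧
        U (-1) 0 2 ≠ 0 ∧ (∀ t < 0, ∀ x, Real.sqrt (-t) * |U t x 2| ≤ |U (-1) 0 2|) ∧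
        (∀ h : EuclideanSpace ℝ (Fin 3), fderiv ℝ (U (-1)) 0 h 2 = 0) ∧
        (deriv (fun s => U s 0 2) (-1) = U (-1) 0 2 / 2 ∧ U (-1) 0 2 * (Δ (fun q => U (-1) q 2)) 0 ≤ 0)))
    (hKU : (∀ (s₁ z₁ σ₁ M₁ : ℝ) (K₁ O₁ : Set (EuclideanSpace ℝ (Fin 3))), s₁ < 0 →
        ((σ₁ = 1 ∨ σ₁ = -1) ∧ IsCompact K₁ ∧ K₁.Nonempty ∧ (∀ q ∈ K₁, q 2 = z₁ ∧ σ₁ * U s₁ q 2 = M₁) ∧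
          IsOpen O₁ ∧ K₁ ⊆ O₁ ∧ (∀ q ∈ O₁, q 2 = z₁ → σ₁ * U s₁ q 2 ≤ M₁) ∧
          (∀ q ∈ O₁, q 2 = z₁ → σ₁ * U s₁ q 2 = M₁ → q ∈ K₁)) → False))
    (hτs : Tendsto τs atTop l)
    (hVt : ∀ t < 0, TendstoLocallyUniformly (fun k x => v t (x + γ (τs k))) (U t) atTop)
    (hW : TendstoLocallyUniformly (fun k x => curl (v (-1)) (x + γ (τs k))) (curl (U (-1))) atTop)
    {γU : ℝ → EuclideanSpace ℝ (Fin 3)} (hγU0 : γU 0 = 0) (hγU : ∀ σ, HasDerivAt γU (curl (U (-1)) (γU σ)) σ) (σ : ℝ) :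
    (Literature.Analysis.FluidPDE.HasTypeITimeDecay C (fun t x => U t (x + γU σ)) ∧
      ContinuousOn (Function.uncurry (fun t x => U t (x + γU σ))) (Set.Iio (0 : ℝ) ×ˢ Set.univ) ∧
      (∀ s t : ℝ, s < t → t < 0 → ∀ x, (fun t x => U t (x + γU σ)) t x =
        Literature.Analysis.UnboundedOperators.heatExtension ((fun t x => U t (x + γU σ)) s) (t - s) x -
          Literature.Analysis.FluidPDE.oseenDuhamel 1 s (fun t x => U t (x + γU σ)) (fun t x => U t (x + γU σ)) t x) ∧
      (∀ t < 0, Literature.Analysis.FluidPDE.VectorCalculus.IsDivFree ((fun t x => U t (x + γU σ)) t)) ∧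
      (∀ s < 0, ∀ q, ⟪Literature.Analysis.FluidPDE.curl ((fun t x => U t (x + γU σ)) s) q, EuclideanSpace.single 2 1⟫_ℝ = 0) ∧
      (fun t x => U t (x + γU σ)) (-1) 0 2 ≠ 0 ∧ (∀ t < 0, ∀ x, Real.sqrt (-t) * |(fun t x => U t (x + γU σ)) t x 2| ≤ |(fun t x => U t (x + γU σ)) (-1) 0 2|) ∧
      (∀ h : EuclideanSpace ℝ (Fin 3), fderiv ℝ ((fun t x => U t (x + γU σ)) (-1)) 0 h 2 = 0) ∧
      (deriv (fun s => (fun t x => U t (x + γU σ)) s 0 2) (-1) = (fun t x => U t (x + γU σ)) (-1) 0 2 / 2 ∧ (fun t x => U t (x + γU σ)) (-1) 0 2 * (Δ (fun q => (fun t x => U t (x + γU σ)) (-1) q 2)) 0 ≤ 0)) ∧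
    (∀ (s₁ z₁ σ₁ M₁ : ℝ) (K₁ O₁ : Set (EuclideanSpace ℝ (Fin 3))), s₁ < 0 →
      ((σ₁ = 1 ∨ σ₁ = -1) ∧ IsCompact K₁ ∧ K₁.Nonempty ∧ (∀ q ∈ K₁, q 2 = z₁ ∧ σ₁ * (fun t x => U t (x + γU σ)) s₁ q 2 = M₁) ∧
        IsOpen O₁ ∧ K₁ ⊆ O₁ ∧ (∀ q ∈ O₁, q 2 = z₁ → σ₁ * (fun t x => U t (x + γU σ)) s₁ q 2 ≤ M₁) ∧
        (∀ q ∈ O₁, q 2 = z₁ → σ₁ * (fun t x => U t (x + γU σ)) s₁ q 2 = M₁ → q ∈ K₁)) → False) ∧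
    Tendsto (fun k => τs k + σ) atTop l ∧
    (∀ t < 0, TendstoLocallyUniformly (fun k x => v t (x + γ (τs k + σ))) ((fun t x => U t (x + γU σ)) t) atTop) ∧
    TendstoLocallyUniformly (fun k x => curl (v (-1)) (x + γ (τs k + σ))) (curl ((fun t x => U t (x + γU σ)) (-1))) atTop := by
  obtain ⟨hhotU, hreb⟩ := hull_leaf hP hγ hhot hPU (hVt (-1) (by norm_num)) hW hγU0 hγU
  have hUc : ∀ t < 0, Continuous (U t) := fun t ht => continuous_slice_of_class hPU.1 hPU.2.1 hPU.2.2.1 hPU.2.2.2.1 ht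
  obtain ⟨KU, LU, hKU', -⟩ := curl_slice_bounded_lipschitz hPU.1 hPU.2.1 hPU.2.2.1 hPU.2.2.2.1 (by norm_num : (-1 : ℝ) < 0)
  refine ⟨pinned_translate hPU (hhotU σ), peakless_translate hKU (γU σ), ?_, ?_, ?_⟩
  · rcases hl with rfl | rfl
    · exact tendsto_atTop_add_const_right _ σ hτs
    · exact tendsto_atBot_add_const_right _ σ hτs
  · intro t ht
    have e : (fun k x => v t (x + γ (τs k + σ))) = fun k x => (fun k x => v t (x + γ (τs k))) k (x + (γ (τs k + σ) - γ (τs k))) := by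
      funext k x
      simp only [add_assoc, sub_add_cancel]
    rw [e]
    exact tendstoLocallyUniformly_comp_add (hVt t ht) (hUc t ht) (hreb σ)
  · have e : (fun k x => curl (v (-1)) (x + γ (τs k + σ))) =
        fun k x => (fun k x => curl (v (-1)) (x + γ (τs k))) k (x + (γ (τs k + σ) - γ (τs k))) := by
      funext k x
      simp only [add_assoc, sub_add_cancel]
    rw [e, show curl ((fun t x => U t (x + γU σ)) (-1)) = fun x => curl (U (-1)) (x + γU σ) from curl_slide (U (-1)) (γU σ)]
    exact tendstoLocallyUniformly_comp_add hW hKU'.continuous (hreb σ)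

/-- **Diagonal lemma: a slice-wise limit of hull members is a hull member.** -/
theorem hull_diagonal {C : ℝ} {v U : ℝ → EuclideanSpace ℝ (Fin 3) → EuclideanSpace ℝ (Fin 3)} {γ : ℝ → EuclideanSpace ℝ (Fin 3)}
    {l : Filter ℝ} (hl : l = Filter.atTop ∨ l = Filter.atBot)
    (hP : (Literature.Analysis.FluidPDE.HasTypeITimeDecay C v ∧
        ContinuousOn (Function.uncurry v) (Set.Iio (0 : ℝ) ×ˢ Set.univ) ∧
        (∀ s t : ℝ, s < t → t < 0 → ∀ x, v t x =
          Literature.Analysis.UnboundedOperators.heatExtension (v s) (t - s) x -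
            Literature.Analysis.FluidPDE.oseenDuhamel 1 s v v t x) ∧
        (∀ t < 0, Literature.Analysis.FluidPDE.VectorCalculus.IsDivFree (v t)) ∧
        (∀ s < 0, ∀ q, ⟪Literature.Analysis.FluidPDE.curl (v s) q, EuclideanSpace.single 2 1⟫_ℝ = 0) ∧
        v (-1) 0 2 ≠ 0 ∧ (∀ t < 0, ∀ x, Real.sqrt (-t) * |v t x 2| ≤ |v (-1) 0 2|) ∧
        (∀ h : EuclideanSpace ℝ (Fin 3), fderiv ℝ (v (-1)) 0 h 2 = 0) ∧
        (deriv (fun s => v s 0 2) (-1) = v (-1) 0 2 / 2 ∧ v (-1) 0 2 * (Δ (fun q => v (-1) q 2)) 0 ≤ 0)))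
    {Ws : ℕ → ℝ → EuclideanSpace ℝ (Fin 3) → EuclideanSpace ℝ (Fin 3)} {τss : ℕ → ℕ → ℝ}
    (hPW : ∀ j, (Literature.Analysis.FluidPDE.HasTypeITimeDecay C (Ws j) ∧
        ContinuousOn (Function.uncurry (Ws j)) (Set.Iio (0 : ℝ) ×ˢ Set.univ) ∧
        (∀ s t : ℝ, s < t → t < 0 → ∀ x, (Ws j) t x =
          Literature.Analysis.UnboundedOperators.heatExtension ((Ws j) s) (t - s) x -
            Literature.Analysis.FluidPDE.oseenDuhamel 1 s (Ws j) (Ws j) t x) ∧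
        (∀ t < 0, Literature.Analysis.FluidPDE.VectorCalculus.IsDivFree ((Ws j) t)) ∧
        (∀ s < 0, ∀ q, ⟪Literature.Analysis.FluidPDE.curl ((Ws j) s) q, EuclideanSpace.single 2 1⟫_ℝ = 0) ∧
        (Ws j) (-1) 0 2 ≠ 0 ∧ (∀ t < 0, ∀ x, Real.sqrt (-t) * |(Ws j) t x 2| ≤ |(Ws j) (-1) 0 2|) ∧
        (∀ h : EuclideanSpace ℝ (Fin 3), fderiv ℝ ((Ws j) (-1)) 0 h 2 = 0) ∧
        (deriv (fun s => (Ws j) s 0 2) (-1) = (Ws j) (-1) 0 2 / 2 ∧ (Ws j) (-1) 0 2 * (Δ (fun q => (Ws j) (-1) q 2)) 0 ≤ 0)))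
    (hτss : ∀ j, Tendsto (τss j) atTop l)
    (hVj : ∀ j, ∀ t < 0, TendstoLocallyUniformly (fun k x => v t (x + γ (τss j k))) (Ws j t) atTop)
    (hWj : ∀ j, TendstoLocallyUniformly (fun k x => curl (v (-1)) (x + γ (τss j k))) (curl (Ws j (-1))) atTop)
    (hPU : (Literature.Analysis.FluidPDE.HasTypeITimeDecay C U ∧
        ContinuousOn (Function.uncurry U) (Set.Iio (0 : ℝ) ×ˢ Set.univ) ∧
        (∀ s t : ℝ, s < t → t < 0 → ∀ x, U t x =
          Literature.Analysis.UnboundedOperators.heatExtension (U s) (t - s) x -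
            Literature.Analysis.FluidPDE.oseenDuhamel 1 s U U t x) ∧
        (∀ t < 0, Literature.Analysis.FluidPDE.VectorCalculus.IsDivFree (U t)) ∧
        (∀ s < 0, ∀ q, ⟪Literature.Analysis.FluidPDE.curl (U s) q, EuclideanSpace.single 2 1⟫_ℝ = 0) ∧
        U (-1) 0 2 ≠ 0 ∧ (∀ t < 0, ∀ x, Real.sqrt (-t) * |U t x 2| ≤ |U (-1) 0 2|) ∧
        (∀ h : EuclideanSpace ℝ (Fin 3), fderiv ℝ (U (-1)) 0 h 2 = 0) ∧
        (deriv (fun s => U s 0 2) (-1) = U (-1) 0 2 / 2 ∧ U (-1) 0 2 * (Δ (fun q => U (-1) q 2)) 0 ≤ 0)))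
    (hlim : ∀ t < 0, TendstoLocallyUniformly (fun j => Ws j t) (U t) atTop)
    (hlimc : TendstoLocallyUniformly (fun j => curl (Ws j (-1))) (curl (U (-1))) atTop) :
    ∃ τs : ℕ → ℝ, Tendsto τs atTop l ∧
      (∀ t < 0, TendstoLocallyUniformly (fun k x => v t (x + γ (τs k))) (U t) atTop) ∧
      TendstoLocallyUniformly (fun k x => curl (v (-1)) (x + γ (τs k))) (curl (U (-1))) atTop := by
  classical
  haveI : l.IsCountablyGenerated := by rcases hl with rfl | rfl <;> infer_instance
  obtain ⟨s, hs⟩ := l.exists_antitone_basis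
  -- the compact slabs
  let Sn : ℕ → Set (ℝ × EuclideanSpace ℝ (Fin 3)) := fun n =>
    Icc (-((n : ℝ) + 2)) (-((n : ℝ) + 2)⁻¹) ×ˢ closedBall (0 : EuclideanSpace ℝ (Fin 3)) ((n : ℝ) + 2)
  have hn2 : ∀ n : ℕ, (1 : ℝ) ≤ (n : ℝ) + 2 := fun n => by have := n.cast_nonneg (α := ℝ); linarith
  have hm1 : ∀ n : ℕ, (-1 : ℝ) ∈ Icc (-((n : ℝ) + 2)) (-((n : ℝ) + 2)⁻¹) := fun n =>
    ⟨by linarith [hn2 n], by rw [neg_le_neg_iff]; exact inv_le_one_of_one_le₀ (hn2 n)⟩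
  -- class facts: the translates of `v` are class profiles; slices are continuous
  have hcT : ∀ y : EuclideanSpace ℝ (Fin 3), HasTypeITimeDecay C (fun t x => v t (x + y)) ∧
      ContinuousOn (uncurry fun t x => v t (x + y)) (Iio (0 : ℝ) ×ˢ univ) ∧
      (∀ s t : ℝ, s < t → t < 0 → ∀ x, (fun t x => v t (x + y)) t x =
        heatExtension ((fun t x => v t (x + y)) s) (t - s) x - oseenDuhamel 1 s (fun t x => v t (x + y)) (fun t x => v t (x + y)) t x) ∧
      (∀ t < 0, VectorCalculus.IsDivFree ((fun t x => v t (x + y)) t)) := fun y => by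
    obtain ⟨h1, h2, h3⟩ := PoloidalWindowDoorPoloidalWindowRigidityLeafUniformPins.class_translate hP.1 hP.2.1 hP.2.2.1 y
    exact ⟨h1, h2, h3, fun t ht => isDivFree_translate_arg (hP.2.2.2.1 t ht) y⟩
  have hWc : ∀ j, ∀ t < 0, Continuous (Ws j t) := fun j t ht =>
    continuous_slice_of_class (hPW j).1 (hPW j).2.1 (hPW j).2.2.1 (hPW j).2.2.2.1 ht
  have hUc : ∀ t < 0, Continuous (U t) := fun t ht => continuous_slice_of_class hPU.1 hPU.2.1 hPU.2.2.1 hPU.2.2.2.1 ht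
  -- slab-uniform convergence of the translates to `Ws j`, and of `Ws j` to `U`
  have hslabj : ∀ j n, TendstoUniformlyOn (fun k (p : ℝ × EuclideanSpace ℝ (Fin 3)) => v p.1 (p.2 + γ (τss j k))) (uncurry (Ws j)) atTop (Sn n) :=
    fun j n => tendstoUniformlyOn_slab C (u := fun k t x => v t (x + γ (τss j k))) (U := Ws j) (fun k => (hcT _).1) (fun k => (hcT _).2.1)
      (fun k => (hcT _).2.2.1) (fun k => (hcT _).2.2.2) (hPW j).1 (hPW j).2.1 (hPW j).2.2.1 (hPW j).2.2.2.1
      (fun t ht x => (hVj j t ht).tendsto_comp ((hWc j t ht).continuousAt) tendsto_const_nhds) (hn2 n)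
  have hslabU : ∀ n, TendstoUniformlyOn (fun j (p : ℝ × EuclideanSpace ℝ (Fin 3)) => Ws j p.1 p.2) (uncurry U) atTop (Sn n) :=
    fun n => tendstoUniformlyOn_slab C (u := Ws) (U := U) (fun j => (hPW j).1) (fun j => (hPW j).2.1) (fun j => (hPW j).2.2.1)
      (fun j => (hPW j).2.2.2.1) hPU.1 hPU.2.1 hPU.2.2.1 hPU.2.2.2.1
      (fun t ht x => (hlim t ht).tendsto_comp ((hUc t ht).continuousAt) tendsto_const_nhds) (hn2 n)
  have hcurlj : ∀ j n, TendstoUniformlyOn (fun k x => curl (v (-1)) (x + γ (τss j k))) (curl (Ws j (-1))) atTop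
      (closedBall (0 : EuclideanSpace ℝ (Fin 3)) ((n : ℝ) + 2)) :=
    fun j n => (tendstoLocallyUniformly_iff_forall_isCompact.1 (hWj j)) _ (isCompact_closedBall _ _)
  have hcurlU : ∀ n, TendstoUniformlyOn (fun j => curl (Ws j (-1))) (curl (U (-1))) atTop
      (closedBall (0 : EuclideanSpace ℝ (Fin 3)) ((n : ℝ) + 2)) :=
    fun n => (tendstoLocallyUniformly_iff_forall_isCompact.1 hlimc) _ (isCompact_closedBall _ _)
  -- the diagonal choice
  have hchoice : ∀ j : ℕ, ∃ k : ℕ, τss j k ∈ s j ∧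
      (∀ p ∈ Sn j, dist (Ws j p.1 p.2) (v p.1 (p.2 + γ (τss j k))) < 1 / ((j : ℝ) + 1)) ∧
      (∀ x ∈ closedBall (0 : EuclideanSpace ℝ (Fin 3)) ((j : ℝ) + 2),
        dist (curl (Ws j (-1)) x) (curl (v (-1)) (x + γ (τss j k))) < 1 / ((j : ℝ) + 1)) := by
    intro j
    have hε : (0 : ℝ) < 1 / ((j : ℝ) + 1) := by positivity
    have h1 : ∀ᶠ k in atTop, τss j k ∈ s j := (hs.1.tendsto_right_iff.1 (hτss j)) j trivial
    have h2 := Metric.tendstoUniformlyOn_iff.1 (hslabj j j) _ hε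
    have h3 := Metric.tendstoUniformlyOn_iff.1 (hcurlj j j) _ hε
    obtain ⟨k, hk1, hk2, hk3⟩ := (h1.and (h2.and h3)).exists
    exact ⟨k, hk1, fun p hp => hk2 p hp, fun x hx => hk3 x hx⟩
  choose ks hks using hchoice
  refine ⟨fun j => τss j (ks j), ?_, ?_, ?_⟩
  · -- `τs → l`
    rw [hs.1.tendsto_right_iff]
    intro i _
    filter_upwards [eventually_ge_atTop i] with j hj
    exact hs.2 hj (hks j).1
  · -- slices
    intro t ht
    rw [tendstoLocallyUniformly_iff_forall_isCompact]
    intro Kc hKc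
    obtain ⟨r, hr⟩ := hKc.isBounded.subset_closedBall 0
    obtain ⟨n, hn⟩ := exists_nat_ge (max (max r (-t)) (-t)⁻¹)
    have hnr : r ≤ (n : ℝ) + 2 := by linarith [le_max_left (max r (-t)) (-t)⁻¹, le_max_left r (-t)]
    have ht1 : -((n : ℝ) + 2) ≤ t := by linarith [le_max_left (max r (-t)) (-t)⁻¹, le_max_right r (-t)]
    have ht2 : t ≤ -((n : ℝ) + 2)⁻¹ := by
      have h1 : (-t)⁻¹ ≤ (n : ℝ) + 2 := by linarith [le_max_right (max r (-t)) (-t)⁻¹]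
      have h2 : ((n : ℝ) + 2)⁻¹ ≤ -t := inv_le_of_inv_le₀ (by linarith) h1
      linarith
    rw [Metric.tendstoUniformlyOn_iff]
    intro ε hε
    obtain ⟨m, hm⟩ := exists_nat_gt (2 / ε)
    have hU' := Metric.tendstoUniformlyOn_iff.1 (hslabU n) (ε / 2) (half_pos hε)
    filter_upwards [hU', eventually_ge_atTop (max n m)] with j hj hjm x hx
    have hjn : n ≤ j := le_trans (le_max_left _ _) hjm
    have hjm' : m ≤ j := le_trans (le_max_right _ _) hjm
    have hp : (t, x) ∈ Sn n := mem_prod.2 ⟨⟨ht1, ht2⟩, closedBall_subset_closedBall hnr (hr hx)⟩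
    have hpj : (t, x) ∈ Sn j := by
      have hnj : (n : ℝ) + 2 ≤ (j : ℝ) + 2 := by have := Nat.cast_le (α := ℝ).2 hjn; linarith
      refine mem_prod.2 ⟨⟨by linarith, le_trans ht2 ?_⟩, closedBall_subset_closedBall (hnr.trans hnj) (hr hx)⟩
      rw [neg_le_neg_iff]
      exact inv_anti₀ (by linarith [hn2 n]) hnj
    have hsmall : 1 / ((j : ℝ) + 1) < ε / 2 := by
      have hj1 : (2 / ε : ℝ) < (j : ℝ) + 1 := by
        have := Nat.cast_le (α := ℝ).2 hjm'
        linarith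
      rw [div_lt_iff₀ (by positivity)]
      rw [div_lt_iff₀ hε] at hj1
      linarith
    calc dist (U t x) (v t (x + γ (τss j (ks j))))
        ≤ dist (U t x) (Ws j t x) + dist (Ws j t x) (v t (x + γ (τss j (ks j)))) := dist_triangle _ _ _
      _ < ε / 2 + ε / 2 := add_lt_add (hj (t, x) hp) (((hks j).2.1 (t, x) hpj).trans hsmall)
      _ = ε := add_halves ε
  · -- vorticity slice
    rw [tendstoLocallyUniformly_iff_forall_isCompact]
    intro Kc hKc
    obtain ⟨r, hr⟩ := hKc.isBounded.subset_closedBall 0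
    obtain ⟨n, hn⟩ := exists_nat_ge r
    have hnr : r ≤ (n : ℝ) + 2 := by linarith
    rw [Metric.tendstoUniformlyOn_iff]
    intro ε hε
    obtain ⟨m, hm⟩ := exists_nat_gt (2 / ε)
    have hU' := Metric.tendstoUniformlyOn_iff.1 (hcurlU n) (ε / 2) (half_pos hε)
    filter_upwards [hU', eventually_ge_atTop (max n m)] with j hj hjm x hx
    have hjn : n ≤ j := le_trans (le_max_left _ _) hjm
    have hjm' : m ≤ j := le_trans (le_max_right _ _) hjm
    have hx' : x ∈ closedBall (0 : EuclideanSpace ℝ (Fin 3)) ((n : ℝ) + 2) := closedBall_subset_closedBall hnr (hr hx)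
    have hxj : x ∈ closedBall (0 : EuclideanSpace ℝ (Fin 3)) ((j : ℝ) + 2) := by
      have hnj : (n : ℝ) + 2 ≤ (j : ℝ) + 2 := by have := Nat.cast_le (α := ℝ).2 hjn; linarith
      exact closedBall_subset_closedBall (hnr.trans hnj) (hr hx)
    have hsmall : 1 / ((j : ℝ) + 1) < ε / 2 := by
      have hj1 : (2 / ε : ℝ) < (j : ℝ) + 1 := by
        have := Nat.cast_le (α := ℝ).2 hjm'
        linarith
      rw [div_lt_iff₀ (by positivity)]
      rw [div_lt_iff₀ hε] at hj1
      linarith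
    calc dist (curl (U (-1)) x) (curl (v (-1)) (x + γ (τss j (ks j))))
        ≤ dist (curl (U (-1)) x) (curl (Ws j (-1)) x) + dist (curl (Ws j (-1)) x) (curl (v (-1)) (x + γ (τss j (ks j)))) :=
          dist_triangle _ _ _
      _ < ε / 2 + ε / 2 := add_lt_add (hj x hx') (((hks j).2.2 x hxj).trans hsmall)
      _ = ε := add_halves ε

end Summit.NavierStokesRegularity.NavierStokesRegularity.Theorems.PoloidalWindowDoorPoloidalWindowRigidityHotHullSlidingHull

end
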